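import Summits.KontsevichZagierPeriods.KontsevichZagierPeriods.Theorems.SymplecticScissorsRealOnePeriodRelationsStubFamAlternatives
import Summits.KontsevichZagierPeriods.KontsevichZagierPeriods.Theorems.SymplecticScissorsRealOnePeriodRelationsStubFamSubAlg
import Summits.KontsevichZagierPeriods.KontsevichZagierPeriods.Theorems.SymplecticScissorsRealOnePeriodRelationsStubFamPointsAlg
import Summits.KontsevichZagierPeriods.KontsevichZagierPeriods.Theorems.SymplecticScissorsRealOnePeriodRelationsStubFamDichotomyOfEngine
import Literature.NumberTheory.Transcendental.ManyCurveThetaClassification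
import HarnessLib

/-!
# Crux `RealOnePeriodRelations` (stmt-KontsevichZagierPeriods-10042),
# line `nash-retraction-thin-strip`, stub `stub_famInductionOfEngine`:
# the Semistability Theorem for the family standard models at ALL algebraic points from the engine

Baker–Wüstholz's Semistability Theorem (op. cit. Thm. 6.15) for the FAMILY standard models
`M = 𝔾ₘ^β × P` of `Literature/NumberTheory/Transcendental/ManyCurveStd.lean` (lattice family
`L : J → PeriodPair` of pairwise non-isogenous lattices with algebraic invariants, class map
`cls : γ → J` whose CM classes carry at most one block, extension data `κ`) at ALL algebraic points
(`GaGmEFam.Std.Alg`, not `AlgTors`), by strong induction on `n = dim M`, from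

* the family Baker ENGINE at the REDUCED algebraic points of all standard models of `L` (the
  hypothesis `heng`: each `E`-coordinate of the point a vector of its block's lattice or without
  torsion modulo it);
* Philippon's zero estimate for the family theta models — the tree's THEOREM `philippon_family`
  (`ManyCurveThetaClassification.lean`);
* the landed second run of Baker's method at points with torsion abelian part,
  `GaGmEFam.Std.torsionDichotomy` (`ManyCurveClosing.lean`);
* the quotient/subgroup transports of `ManyCurveStdQuot.lean` / `ManyCurveSub.lean` /
  `ManyCurveInduction.lean` and the four landed stubs of this line (`stub_famDichotomyOfEngine`,
  `stub_famPointsAlg`, `stub_famSubAlg`, `QuotData.Φ_mem_Alg`).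

It is the family port of two one-lattice tree theorems of `SemistabilityStdOfPhilippon.lean`:

* `mem_ker_of_stable_algFam` — the STABLE case at an arbitrary algebraic point
  (`GaGmE.Std.mem_ker_of_stable_algR`): a reduced multiple `N·w` (`exists_reduced_multiple_fam`),
  the first run there (`stub_famDichotomyOfEngine`), `Lie K = 0` by stability
  (`Semistable.exists_borderline_rational`), so `rN·w ∈ ker` and `w` has torsion abelian part
  (`mem_AlgTors_of_smul_mem_ker_fam`); the second run `torsionDichotomy` closes;
* `stub_famInductionOfEngine` — the induction over borderline quotients and subgroups
  (`GaGmE.Std.mem_ker_of_semistable_card_algR`, i.e. `GaGmEFam.Std.mem_ker_of_semistable_card`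
  with `Alg` for `AlgTors`: `stub_famPointsAlg` and `QuotData.Φ_mem_Alg` at the division points,
  `stub_famSubAlg` in the subgroup step).

References: A. Baker, G. Wüstholz, *Logarithmic Forms and Diophantine Geometry*, New Math.
Monogr. 9, CUP 2007, Thm. 6.15, §6.7, §6.8 (p. 115: induction over `G^*` and `B ∩ ker π`;
pp. 116–119). [BakerWustholz2007]
P. Philippon, *Lemmes de zéros dans les groupes algébriques commutatifs*, Bull. SMF 114 (1986),
Thm. 2.1. [Philippon1986]
-/

noncomputable section

open Complex Module Submodule
open Literature.NumberTheory.Transcendental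

namespace Summit.KontsevichZagierPeriods.SymplecticScissors.RealOnePeriodRelations.MultiEllLayer

/-! ### The stable case at all algebraic points -/

/-- **The Semistability Theorem for a STABLE `𝔟` of a family standard model at ALL algebraic
points** (modulo Philippon's zero estimate `hphil` for the family theta model and the engine
output `heng` at the REDUCED algebraic points of `𝔟`). Let `𝔟 ⊊ Lie M` be `ℚ̄`-rational and
semistable with no borderline connected algebraic `0 ≠ K ≠ M` (`hst`), and `w ∈ 𝔟` with
`exp_M(w)` algebraic. Then `w ∈ ker(exp_M)`: a multiple `N·w` (`N ≥ 1`) is reduced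
(`exists_reduced_multiple_fam`); the first run at `N·w` (`stub_famDichotomyOfEngine`) gives a
borderline obstruction `K` over `ℂ` with `r·N·w ∈ Lie K + ker`; by stability `Lie K = 0`, so
`rN·w ∈ ker`, `w` has TORSION abelian part, and the landed second run
`GaGmEFam.Std.torsionDichotomy` closes. The family twin of `GaGmE.Std.mem_ker_of_stable_algR`.
[cite: BakerWustholz2007, Thm. 6.15, §6.8 (p. 115; pp. 116–119)] -/
theorem mem_ker_of_stable_algFam {J : Type} [Fintype J] [DecidableEq J] (L : J → PeriodPair)
    (hL : ∀ i, IsAlgebraic ℚ (L i).g₂ ∧ IsAlgebraic ℚ (L i).g₃)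
    {β γ δ : Type} [Fintype β] [Fintype γ] [Fintype δ] [DecidableEq β] [DecidableEq γ]
    [DecidableEq δ] (cls : γ → J) (κM : δ → γ → GaGmE.Kbar)
    (hphil : ∃ c : ℝ, 0 < c ∧ ∀ (𝔟 : Submodule ℂ (β ⊕ (γ ⊕ δ) → ℂ)) (v : β ⊕ (γ ⊕ δ) → ℂ)
      (P : MvPolynomial (Option β × GaGmE.Std.ThetaIdx γ δ) ℂ) (D S T : ℕ),
      0 < Module.finrank ℂ 𝔟 → 1 ≤ D → 1 ≤ S → P.IsHomogeneous D →
      (∃ w, GaGmEFam.Std.thetaEval L cls κM P w ≠ 0) →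
      (∀ s : ℕ, s ≤ Fintype.card (β ⊕ (γ ⊕ δ)) * S →
        GaGmE.Std.VanishesAlong 𝔟 (GaGmEFam.Std.thetaEval L cls κM P) ((s : ℂ) • v)
          (Fintype.card (β ⊕ (γ ⊕ δ)) * T + 1)) →
      ∃ K : GaGmEFam.Std.SubgroupDataC β γ δ cls κM,
        (∃ w₀, ∀ w ∈ K.tangent, GaGmEFam.Std.thetaEval L cls κM P (w₀ + w) = 0) ∧
        (Nat.choose (T + (Module.finrank ℂ 𝔟 - Module.finrank ℂ ↥(𝔟 ⊓ K.tangent)))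
            (Module.finrank ℂ 𝔟 - Module.finrank ℂ ↥(𝔟 ⊓ K.tangent)) : ℝ) *
          (GaGmEFam.Std.orbitCard L cls κM K v S : ℝ) * (D : ℝ) ^ Module.finrank ℂ K.tangent ≤
          c * (D : ℝ) ^ Fintype.card (β ⊕ (γ ⊕ δ)))
    {𝔟 : Submodule ℂ (β ⊕ (γ ⊕ δ) → ℂ)} (hrat : LiePresentation.IsKRational GaGmE.Kbar 𝔟)
    (h𝔟 : 𝔟 ≠ ⊤) (hss : GaGmEFam.Std.Semistable cls κM 𝔟)
    (hst : ∀ D : GaGmEFam.Std.SubgroupData β γ δ cls κM, D.tangent ≠ ⊤ → D.tangent ≠ ⊥ →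
      Module.finrank ℂ 𝔟 * (Fintype.card (β ⊕ (γ ⊕ δ)) - Module.finrank ℂ D.tangent) ≠
        (Module.finrank ℂ 𝔟 - Module.finrank ℂ ↥(𝔟 ⊓ D.tangent)) * Fintype.card (β ⊕ (γ ⊕ δ)))
    {w : β ⊕ (γ ⊕ δ) → ℂ} (hw𝔟 : w ∈ 𝔟) (hw : w ∈ GaGmEFam.Std.Alg L cls κM)
    (heng : ∀ w' ∈ 𝔟, w' ∈ GaGmEFam.Std.Alg L cls κM →
      (∀ b, w' (GaGmE.Std.iz b) ∈ (L (cls b)).lattice ∨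
        ∀ s : ℕ, s ≠ 0 → (s : ℂ) * w' (GaGmE.Std.iz b) ∉ (L (cls b)).lattice) →
      0 < Module.finrank ℂ 𝔟 → ∀ c : ℝ, 0 < c →
      ∃ (D S T : ℕ) (P : MvPolynomial (Option β × GaGmE.Std.ThetaIdx γ δ) ℂ), 1 ≤ D ∧ 1 ≤ S ∧
        P.IsHomogeneous D ∧ (∃ w'', GaGmEFam.Std.thetaEval L cls κM P w'' ≠ 0) ∧
        (∀ s : ℕ, s ≤ Fintype.card (β ⊕ (γ ⊕ δ)) * S →
          GaGmE.Std.VanishesAlong 𝔟 (GaGmEFam.Std.thetaEval L cls κM P) ((s : ℂ) • w')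
            (Fintype.card (β ⊕ (γ ⊕ δ)) * T + 1)) ∧
        ∀ e m : ℕ, m < Fintype.card (β ⊕ (γ ⊕ δ)) →
          Module.finrank ℂ 𝔟 * (Fintype.card (β ⊕ (γ ⊕ δ)) - m) ≤ e * Fintype.card (β ⊕ (γ ⊕ δ)) →
          c * (D : ℝ) ^ Fintype.card (β ⊕ (γ ⊕ δ)) <
              (Nat.choose (T + e) e : ℝ) * ((S : ℝ) + 1) * (D : ℝ) ^ m ∧
          (Module.finrank ℂ 𝔟 * (Fintype.card (β ⊕ (γ ⊕ δ)) - m) < e * Fintype.card (β ⊕ (γ ⊕ δ)) →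
            c * (D : ℝ) ^ Fintype.card (β ⊕ (γ ⊕ δ)) < (Nat.choose (T + e) e : ℝ) * (D : ℝ) ^ m)) :
    w ∈ GaGmEFam.Std.ker L cls κM := by
  -- adapted from `GaGmE.Std.mem_ker_of_stable_algR` (`SemistabilityStdOfPhilippon.lean`) and
  -- `GaGmEFam.Std.mem_ker_of_stable` (`ManyCurveClosing.lean`)
  by_contra hwker
  -- a reduced multiple `N·w`
  obtain ⟨N, hN, hred⟩ := exists_reduced_multiple_fam L cls w
  have hNw𝔟 : (N : ℂ) • w ∈ 𝔟 := Submodule.smul_mem _ _ hw𝔟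
  have hNw : (N : ℂ) • w ∈ GaGmEFam.Std.Alg L cls κM := GaGmEFam.Std.nsmul_mem_Alg κM hL hw N
  -- the first run of Baker's method at `N·w`, from the engine output
  obtain ⟨K, hKtop, hbord, r, hr, hrmem⟩ :=
    stub_famDichotomyOfEngine L cls κM hphil hrat h𝔟 hss hNw𝔟 (heng _ hNw𝔟 hNw hred)
  -- by stability, `Lie K = 0`
  have hKbot : K.tangent = ⊥ := by
    by_contra hKbot
    obtain ⟨D, hDtop, hDbot, hDbord⟩ :=
      hss.exists_borderline_rational cls κM hrat K hKtop hKbot hbord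
    exact hst D hDtop hDbot hDbord
  -- so `rN·w` is a period, and `w` has torsion abelian part: the landed second run
  have hrw : ((r * N : ℕ) : ℂ) • w ∈ GaGmEFam.Std.ker L cls κM := by
    have := (GaGmEFam.Std.mem_preimageSubgroup_of_tangent_eq_bot L cls κM hKbot).mp hrmem
    rwa [smul_smul, ← Nat.cast_mul] at this
  have hrN : 0 < r * N := Nat.mul_pos hr hN
  have hwt : w ∈ GaGmEFam.Std.AlgTors L cls κM := mem_AlgTors_of_smul_mem_ker_fam hw hrN hrw
  obtain ⟨K₂, hK₂top, hK₂bot, hK₂bord⟩ :=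
    GaGmEFam.Std.torsionDichotomy L cls hL κM hphil hrat h𝔟 hss hw𝔟 hwt hrN hrw hwker
  obtain ⟨D, hDtop, hDbot, hDbord⟩ :=
    hss.exists_borderline_rational cls κM hrat K₂ hK₂top hK₂bot hK₂bord
  exact hst D hDtop hDbot hDbord

/-! ### The induction over borderline quotients and subgroups -/

/-- **The Semistability Theorem for the family standard models of a lattice family `L` at ALL
algebraic points, at dimension `n`, by strong induction on `n`, from the family Baker ENGINE at
all REDUCED algebraic points of all its standard models** (hypothesis `heng`; Philippon's zero
estimate is the tree's theorem `philippon_family`). Over a borderline `0 ≠ K₀ ≠ M` pass to the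
quotient `M/K₀` (`QuotData.transport`) at all division points `w/m` (`stub_famPointsAlg`,
`QuotData.Φ_mem_Alg`), conclude `w ∈ Lie K₀` by discreteness
(`SubgroupData.mem_tangent_of_forall_exists`, `QuotData.exists_ker_of_Φ_mem_ker`), then pass to the
subgroup `K₀` (`SubData.transport`, `stub_famSubAlg`, `SubData.ι_mem_ker`); the single-block
condition on the CM classes passes to both (`QuotData.cls'_eq_imp`, `SubData.cls'_eq_imp`); the
stable case is `mem_ker_of_stable_algFam`. The proof of
`GaGmEFam.Std.mem_ker_of_semistable_card` / `GaGmE.Std.mem_ker_of_semistable_card_algR` verbatim.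
[cite: BakerWustholz2007, Thm. 6.15, §6.8 (p. 115; pp. 116–119)] -/
theorem stub_famInductionOfEngine {J : Type} [Fintype J] [DecidableEq J] (L : J → PeriodPair)
    (hL : ∀ i, IsAlgebraic ℚ (L i).g₂ ∧ IsAlgebraic ℚ (L i).g₃)
    (hiso : ∀ i j, i ≠ j → ¬ (L i).IsIsogenousTo (L j))
    (heng : ∀ (β γ δ : Type) [Fintype β] [Fintype γ] [Fintype δ] [DecidableEq γ] (cls : γ → J)
      (κM : δ → γ → GaGmE.Kbar) (𝔟 : Submodule ℂ (β ⊕ (γ ⊕ δ) → ℂ)),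
      LiePresentation.IsKRational GaGmE.Kbar 𝔟 → 𝔟 ≠ ⊤ → GaGmEFam.Std.Semistable cls κM 𝔟 →
      ∀ w ∈ 𝔟, w ∈ GaGmEFam.Std.Alg L cls κM →
      (∀ b, w (GaGmE.Std.iz b) ∈ (L (cls b)).lattice ∨
        ∀ s : ℕ, s ≠ 0 → (s : ℂ) * w (GaGmE.Std.iz b) ∉ (L (cls b)).lattice) →
      0 < Module.finrank ℂ 𝔟 → ∀ c : ℝ, 0 < c →
      ∃ (D S T : ℕ) (P : MvPolynomial (Option β × GaGmE.Std.ThetaIdx γ δ) ℂ), 1 ≤ D ∧ 1 ≤ S ∧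
        P.IsHomogeneous D ∧ (∃ w', GaGmEFam.Std.thetaEval L cls κM P w' ≠ 0) ∧
        (∀ s : ℕ, s ≤ Fintype.card (β ⊕ (γ ⊕ δ)) * S →
          GaGmE.Std.VanishesAlong 𝔟 (GaGmEFam.Std.thetaEval L cls κM P) ((s : ℂ) • w) (Fintype.card (β ⊕ (γ ⊕ δ)) * T + 1)) ∧
        ∀ e m : ℕ, m < Fintype.card (β ⊕ (γ ⊕ δ)) →
          Module.finrank ℂ 𝔟 * (Fintype.card (β ⊕ (γ ⊕ δ)) - m) ≤ e * Fintype.card (β ⊕ (γ ⊕ δ)) →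
          c * (D : ℝ) ^ Fintype.card (β ⊕ (γ ⊕ δ)) < (Nat.choose (T + e) e : ℝ) * ((S : ℝ) + 1) * (D : ℝ) ^ m ∧
          (Module.finrank ℂ 𝔟 * (Fintype.card (β ⊕ (γ ⊕ δ)) - m) < e * Fintype.card (β ⊕ (γ ⊕ δ)) →
            c * (D : ℝ) ^ Fintype.card (β ⊕ (γ ⊕ δ)) < (Nat.choose (T + e) e : ℝ) * (D : ℝ) ^ m))
    (n : ℕ) :
    ∀ (β γ δ : Type) [Fintype β] [Fintype γ] [Fintype δ] (cls : γ → J),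
      (∀ b b', cls b = cls b' → (L (cls b)).HasCM → b = b') →
      ∀ (κM : δ → γ → GaGmE.Kbar) (𝔟 : Submodule ℂ (β ⊕ (γ ⊕ δ) → ℂ)),
      Fintype.card (β ⊕ (γ ⊕ δ)) = n →
      LiePresentation.IsKRational GaGmE.Kbar 𝔟 → 𝔟 ≠ ⊤ → GaGmEFam.Std.Semistable cls κM 𝔟 →
      ∀ w ∈ 𝔟, w ∈ GaGmEFam.Std.Alg L cls κM → w ∈ GaGmEFam.Std.ker L cls κM := by
  -- adapted from `GaGmEFam.Std.mem_ker_of_semistable_card` (`ManyCurveInduction.lean`) and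
  -- `GaGmE.Std.mem_ker_of_semistable_card_algR` (`SemistabilityStdOfPhilippon.lean`)
  induction n using Nat.strong_induction_on with
  | _ n ih =>
  intro β γ δ _ _ _ cls hcm1 κM 𝔟 hn hrat h𝔟 hss w hw𝔟 hw
  classical
  by_cases hbord : ∃ D : GaGmEFam.Std.SubgroupData β γ δ cls κM, D.tangent ≠ ⊤ ∧ D.tangent ≠ ⊥ ∧
      finrank ℂ 𝔟 * (Fintype.card (β ⊕ (γ ⊕ δ)) - finrank ℂ D.tangent) =
        (finrank ℂ 𝔟 - finrank ℂ ↥(𝔟 ⊓ D.tangent)) * Fintype.card (β ⊕ (γ ⊕ δ))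
  · -- a borderline `0 ≠ K₀ ≠ M`: induct over `M/K₀` and `K₀`
    obtain ⟨D₀, hD₀top, hD₀bot, hD₀bord⟩ := hbord
    have hk₀lt : finrank ℂ ↥D₀.tangent < n := by
      have := Submodule.finrank_lt hD₀top; simpa [hn] using this
    -- Step 1: `w ∈ Lie K₀`, through the quotient `M/K₀` at all division points `w/m`
    obtain ⟨Q⟩ := GaGmEFam.Std.nonempty_quotData D₀
    obtain ⟨hrat', htop', hss'⟩ := Q.transport hrat h𝔟 hss hD₀top hD₀bord
    have hcard' : Fintype.card Q.σ' < n := by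
      have hk₀pos : 0 < finrank ℂ ↥D₀.tangent := by
        rw [Nat.pos_iff_ne_zero, Ne, Submodule.finrank_eq_zero]; exact hD₀bot
      have := Q.card_eq; rw [hn] at this; omega
    have hwD₀ : w ∈ D₀.tangent := by
      refine D₀.mem_tangent_of_forall_exists (L := L) w fun m hm => ?_
      have hwm : (m : ℂ)⁻¹ • w ∈ GaGmEFam.Std.Alg L cls κM := stub_famPointsAlg hL hw hm
      have hwm𝔟 : (m : ℂ)⁻¹ • w ∈ 𝔟 := Submodule.smul_mem _ _ hw𝔟
      have hΦ : Q.Φ ((m : ℂ)⁻¹ • w) ∈ GaGmEFam.Std.ker L Q.cls' Q.κM' :=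
        ih _ hcard' (Fin Q.nA) Q.B' (Fin Q.nΞ) Q.cls' (Q.cls'_eq_imp hcm1) Q.κM' (𝔟.map Q.Φ)
          rfl hrat' htop' hss' _ (Submodule.mem_map_of_mem hwm𝔟) (Q.Φ_mem_Alg hL hwm)
      obtain ⟨k, hk, hh⟩ := Q.exists_ker_of_Φ_mem_ker hΦ
      refine ⟨k, hk, (m : ℂ)⁻¹ • w - k, hh, ?_⟩
      have hm0 : (m : ℂ) ≠ 0 := by exact_mod_cast hm.ne'
      rw [add_sub_cancel, smul_smul, mul_inv_cancel₀ hm0, one_smul]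
    -- Step 2: transport to the subgroup `K₀`
    obtain ⟨S⟩ := GaGmEFam.Std.nonempty_subData D₀
    obtain ⟨hratS, htopS, hssS⟩ := S.transport hrat h𝔟 hss hD₀top hD₀bot hD₀bord
    have hcardS : Fintype.card S.σ' < n := by rw [S.card_eq]; exact hk₀lt
    obtain ⟨w', hw'⟩ := S.exists_eq_ι hwD₀
    have hw'𝔟 : w' ∈ 𝔟.comap S.ι := by show S.ι w' ∈ 𝔟; rw [hw']; exact hw𝔟
    have hw'alg : w' ∈ GaGmEFam.Std.Alg L S.cls' S.κS :=
      stub_famSubAlg hL S (by rw [hw']; exact hw)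
    have hker' := ih _ hcardS (Fin S.nA) S.B' (Fin S.nΞ) S.cls' (S.cls'_eq_imp hcm1) S.κS
      (𝔟.comap S.ι) rfl hratS htopS hssS w' hw'𝔟 hw'alg
    rw [← hw']
    exact S.ι_mem_ker hker'
  · -- `𝔟` is stable: the two runs of Baker's method, the first one at a reduced multiple
    push Not at hbord
    exact mem_ker_of_stable_algFam L hL cls κM (philippon_family J L hL hiso β γ δ cls hcm1 κM)
      hrat h𝔟 hss (fun D h1 h2 => hbord D h1 h2) hw𝔟 hw
      (fun w' hw'𝔟 hw' hred => heng β γ δ cls κM 𝔟 hrat h𝔟 hss w' hw'𝔟 hw' hred)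

end Summit.KontsevichZagierPeriods.SymplecticScissors.RealOnePeriodRelations.MultiEllLayer

end
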